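import Mathlib.Geometry.Manifold.VectorField.Pullback
import Literature.Geometry.Lorentzian.KillingHorizonShadowAlong
import Literature.Geometry.Lorentzian.EinsteinTensorNaturality
import Literature.Geometry.Lorentzian.ImmersedChartRicci
import Literature.Geometry.Lorentzian.ChartMetricCoord
import Literature.Geometry.Lorentzian.KerrKillingTangency
import Literature.Geometry.Lorentzian.SpacetimeLocalConvergence
import Literature.Geometry.Lorentzian.SpacetimeMetricInCoordsCalculus
import Literature.Geometry.Manifold.InjOnLocalDiffeomorphInverse
import HarnessLib

/-!
# Crux `GapExhaustion` (stmt-FinalStateConjecture-10808), line `photon-shell-pseudoconvexity`: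
# stub (G5-A2) `stub_killingCoord_of_isKillingFieldOn_at` — the chart bridge: a manifold-level
# Killing field on the image of an immersed chart satisfies the COORDINATE Killing equation of
# the pulled-back components

Route `BartnikGapSettling`; helper (`--supports stmt-FinalStateConjecture-10808`) landing the
registered sub-stub (G5-A2) of line lead c8 (wave 4, theme G5). The node of the line speaks of
Killing fields `T, K` of the spacetime `𝓢` on subsets of the image of the eternal star chart
(`𝓢.metric.toPseudoRiemannianMetric.IsKillingFieldOn`), while the unique-continuation / patching
tool of §1e (`killingUniqueContinuation`, `killingPatching`) is stated for solutions of the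
coordinate Killing equation `DG(y)(Kt y)(v,w) + G y (DKt(y) v) w + G y v (DKt(y) w) = 0` of a field
of components `G` on an open subset of `E4`. This file is the bridge manifold ⇒ coordinate: for
an immersed chart `Ψ : E4 → 𝓢.carrier` (smooth on the open `W`, injective differential), the
components `G = 𝓢.metricInCoords Ψ` and the pulled-back field `Kt y = (dΨ_y)⁻¹ (K (Ψ y))`
(Mathlib's `mpullback`), a Killing field `K` of `𝓢` on `Ψ '' W` gives a solution `Kt` of the
coordinate Killing equation at every `y ∈ W` where `Kt` is differentiable (it is in fact `C^∞`,
(G5-A1) `stub_contDiffOn_pullbackField`).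

Proof: on the open submanifold `A = ⟨W, _⟩ : Opens E4` the pullback metric `g' = (Ψ ∘ val)^* g`
(`PseudoRiemannianMetric.comap`) has representative `G` (`val_comap_immersedChart`) and carries the
pulled-back section `K' = mpullback (Ψ ∘ val) K` with representative `Kt`; the Killing form of
`K'` for `g'` at `u = ⟨y, _⟩` is the Killing form of `K` for `g` at `Ψ y` read through `dΨ`
(`val_leviCivita_mpullback_add`), hence zero (`IsKillingFieldOn`, the image `Ψ '' W` being open by
the inverse function theorem); the Levi-Civita connection of `g'` in coordinates
(`OpensChart.leviCivita_apply_eq`) and the algebraic core `OpensChart.killing_coord_of_christoffel`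
turn this into the coordinate Killing equation of `G`. O'Neill 1983, Ch. 9, Prop. 9.25 with
Ch. 3, Prop. 3.59.
-/

noncomputable section

set_option maxSynthPendingDepth 3

-- D-0017: single-problem summit, `Summit.<S>.<S>.…` by design (cf. lakefile `weak.linter.dupNamespace`).
set_option linter.dupNamespace false

namespace Summit.FinalStateConjecture.FinalStateConjecture.Theorems

open Set Function Bundle VectorField TopologicalSpace
open Literature.Geometry.Lorentzian Literature.Geometry.Lorentzian.MetricCoord
open scoped Manifold ContDiff Topology

/-- **Stub (G5-A2) of the line `photon-shell-pseudoconvexity` (crux `GapExhaustion`,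
stmt-FinalStateConjecture-10808) — manifold Killing ⇒ coordinate Killing through an immersed
chart.** Let `Ψ : E4 → 𝓢.carrier` be smooth on the open set `W` with injective differential
there, and let `K` be a Killing field of `𝓢` on `Ψ '' W`
(`𝓢.metric.toPseudoRiemannianMetric.IsKillingFieldOn K (Ψ '' W)`). Then at every `y ∈ W` at
which the pulled-back field `Kt y' = (dΨ_{y'})⁻¹ (K (Ψ y'))` is differentiable, the coordinate
Killing equation of the components `G = 𝓢.metricInCoords Ψ` holds:
`DG(y)(Kt y)(v, w) + G y (DKt(y) v) w + G y v (DKt(y) w) = 0` for all `v, w : E4`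
(O'Neill 1983, Ch. 9, Prop. 9.25, read through the local isometry `(W, Ψ^*g) → (𝓢, g)`,
Ch. 3, Prop. 3.59). [cite: ONeill1983, Ch. 9, Prop. 9.25] -/
theorem stub_killingCoord_of_isKillingFieldOn_at :
    ∀ (𝓢 : Spacetime.{0} 4) [𝓢.metric.HasLeviCivita] (Ψ : E4 → 𝓢.carrier) (W : Set E4)
      (K : Π x : 𝓢.carrier, TangentSpace (𝓡 4) x),
      IsOpen W → ContMDiffOn 𝓘(ℝ, E4) (𝓡 4) ∞ Ψ W →
      (∀ y ∈ W, Function.Injective (mfderiv 𝓘(ℝ, E4) (𝓡 4) Ψ y)) →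
      𝓢.metric.toPseudoRiemannianMetric.IsKillingFieldOn K (Ψ '' W) →
      ∀ y ∈ W,
        DifferentiableAt ℝ (fun y : E4 => (mfderiv 𝓘(ℝ, E4) (𝓡 4) Ψ y).inverse (K (Ψ y))) y →
        ∀ v w : E4,
        fderiv ℝ (𝓢.metricInCoords Ψ) y ((mfderiv 𝓘(ℝ, E4) (𝓡 4) Ψ y).inverse (K (Ψ y))) v w
          + 𝓢.metricInCoords Ψ y
              (fderiv ℝ (fun y : E4 => (mfderiv 𝓘(ℝ, E4) (𝓡 4) Ψ y).inverse (K (Ψ y))) y v) w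
          + 𝓢.metricInCoords Ψ y v
              (fderiv ℝ (fun y : E4 => (mfderiv 𝓘(ℝ, E4) (𝓡 4) Ψ y).inverse (K (Ψ y))) y w)
          = 0 := by
  intro 𝓢 _ Ψ W K hW hΨ hinj hKil y hy hKtd v w
  -- the open submanifold `A` and the pullback metric `g' = (Ψ ∘ val)^* g` on it
  set A : Opens E4 := ⟨W, hW⟩ with hAdef
  have hΨA : ContMDiffOn 𝓘(ℝ, E4) (𝓡 4) ∞ Ψ A := hΨ
  have hinjA : ∀ z ∈ A, Function.Injective (mfderiv 𝓘(ℝ, E4) (𝓡 4) Ψ z) := hinj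
  set g := 𝓢.metric.toPseudoRiemannianMetric with hgdef
  set g' := g.comap PseudoRiemannianMetric.contMDiff_pullbackBilin_holds
    (Ψ ∘ (Subtype.val : A → E4)) (contMDiff_immersedChart_comp_val hΨA)
    (injective_mfderiv_immersedChart_comp_val hΨA hinjA) rfl with hg'def
  haveI := g'.hasLeviCivita
  -- the representative of `g'` is `G = metricInCoords Ψ`
  set G : E4 → E4 →L[ℝ] E4 →L[ℝ] ℝ := 𝓢.metricInCoords Ψ with hGdef
  have hrepr : ∀ z : A, g'.val z = G z := fun z ↦ val_comap_immersedChart g hΨA hinjA rfl z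
  -- the pulled-back section `K'` over `A` and its representative `Kt`
  set Kt : E4 → E4 := fun y => (mfderiv 𝓘(ℝ, E4) (𝓡 4) Ψ y).inverse (K (Ψ y)) with hKtdef
  set K' : Π z : A, TangentSpace 𝓘(ℝ, E4) z :=
    mpullback 𝓘(ℝ, E4) (𝓡 4) (Ψ ∘ (Subtype.val : A → E4)) K with hK'def
  have hK' : ∀ z : A, K' z = Kt z := by
    intro z
    have hd : MDifferentiableAt 𝓘(ℝ, E4) (𝓡 4) Ψ (z : E4) :=
      ((hΨ z.1 z.2).contMDiffAt (hW.mem_nhds z.2)).mdifferentiableAt (by simp)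
    simp only [hK'def, hKtdef, mpullback_apply, Function.comp_apply]
    rw [𝓢.mfderiv_comp_subtypeVal_opens z hd]
    rfl
  -- the image is open, so `K` is differentiable at `Ψ y`
  have hopen : IsOpen (Ψ '' W) :=
    Literature.Geometry.Manifold.isOpen_image_of_bijective_mfderiv hW hΨ fun z hz ↦
      mfderiv_bijective_of_injective (hinj z hz) rfl
  have hKd : MDifferentiableAt (𝓡 4) (𝓡 4).tangent
      (fun x ↦ (TotalSpace.mk' E4 x (K x) : TangentBundle (𝓡 4) 𝓢.carrier)) (Ψ y) :=
    hKil.mdifferentiableAt hopen (mem_image_of_mem Ψ hy)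
  -- the Killing form of `K'` for `g'` at `u = ⟨y, hy⟩` vanishes (naturality + `IsKillingFieldOn`)
  set u : A := ⟨y, hy⟩ with hudef
  have hKd' : MDifferentiableAt (𝓡 4) (𝓡 4).tangent
      (fun x ↦ (TotalSpace.mk' E4 x (K x) : TangentBundle (𝓡 4) 𝓢.carrier))
      ((Ψ ∘ (Subtype.val : A → E4)) u) := hKd
  have hkill : ∀ Y₀ Z₀ : E4, g'.val u (g'.leviCivita K' u Y₀) Z₀ + g'.val u Y₀ (g'.leviCivita K' u Z₀) = 0 := by
    intro Y₀ Z₀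
    have hnat := g.val_leviCivita_mpullback_add PseudoRiemannianMetric.contMDiff_pullbackBilin_holds
      (contMDiff_immersedChart_comp_val hΨA) (injective_mfderiv_immersedChart_comp_val hΨA hinjA)
      rfl hKd' Y₀ Z₀
    rw [hnat]
    exact hKil.val_leviCivita_add (mem_image_of_mem Ψ hy) _ _
  -- the Levi-Civita connection of `g'` in coordinates
  have hKtd' : DifferentiableAt ℝ Kt (u : E4) := hKtd
  have hlc : ∀ X₀ : E4, g'.leviCivita K' u X₀ =
      fderiv ℝ Kt u X₀ + OpensChart.christoffel g' G u (K' u) X₀ := fun X₀ ↦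
    OpensChart.leviCivita_apply_eq hrepr u hK' hKtd' X₀
  -- algebraic core
  have hGd : DifferentiableAt ℝ G (u : E4) := OpensChart.differentiableAt_repr hrepr u
  have hcore := OpensChart.killing_coord_of_christoffel hrepr u hGd (Kt u) (fderiv ℝ Kt u)
    (fun v w ↦ by
      have h := hkill v w
      rw [hlc v, hlc w, hK' u, hrepr u] at h
      exact h) v w
  exact hcore

end Summit.FinalStateConjecture.FinalStateConjecture.Theorems

end
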